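import Literature.Analysis.FluidPDE.QuasiSelfSimilarBuildingBlocks
import Literature.Analysis.FluidPDE.PassiveScalar
import Literature.Analysis.FunctionSpaces.TorusPatchingCalculus
import Literature.Analysis.FunctionSpaces.TorusCellwiseHNegOne
import Literature.Analysis.FunctionSpaces.SpaceTimeSliceDerivatives
import Literature.Analysis.FunctionSpaces.HolderNorm
import HarnessLib

/-!
# The scaling analysis of the quasi-self-similar family (BDL 2023, Thm. 4.1 (a), (b), (4.10);
ACM 2019, §6)

Topic `Literature/Analysis/FluidPDE` (trunk FluidKinetic, family `turb`). Given building blocks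
and labels as in the fact `acm_building_blocks` (`QuasiSelfSimilarBuildingBlocks.lean`), the
patched fields `ρ_n = QuasiSelfSimilar.scalar Θ ι n`, `v_n = QuasiSelfSimilar.velocity V ι n`
(BDL (4.3)–(4.4), mesh `mₙ = 2·5ⁿ`) satisfy everything else Bruè–De Lellis, CMP 400 (2023),
Thm. 4.1 asserts — this is the "scaling analysis" of Alberti–Crippa–Mazzucato, JAMS 32 (2019),
§6 (Lemma 18, §6.4), here PROVED:

* transport and incompressibility on `[0,1] × T²`
  (`QuasiSelfSimilar.isClassicalScalarTransportOn`): in each half-open square the fields are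
  rescaled blocks, `∂ₜ` acts on the block, `D_x ρ_n = mₙ DΘ`, `v_n = mₙ⁻¹ V`, so
  `∂ₜρ_n + v_n·∇ρ_n = (∂ₜΘ + V·∇Θ)(mₙ y - κ) = 0` and `div v_n = (div V)(…) = 0`
  (`Torus.fderiv_patchTorus`; BDL §4.2, ACM §6.2);
* (a) and (4.10) (`QuasiSelfSimilar.exists_holder_bound`, applied in
  `QuasiSelfSimilarFamilyProofs.lean`): for `x ↦ ∂ₜᵏ v_n(t)(x)` and `x ↦ ∂ₜᵏ(v_n·∇v_n)(t)(x)`,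
  which are `mₙ⁻¹`-multiples of fields patched from the jointly smooth blocks `∂ₜᵏV_i`,
  `∂ₜᵏ(DV_i[V_i])`, the `C^{j,r}` norm is `≤ C mₙ^{j+r-1} = C' 5^{(j+r-1)n}`
  (`Torus.eContDiffHolderNorm_patchTorus_le`, compact bounds of the block derivatives);
* (b) (`QuasiSelfSimilar.hasZeroMean_scalar`, `integral_scalar_sq`, `abs_scalar_le`,
  `norm_gradient_scalar_le`, `eHomSobolevSeminorm_scalar_le`): cell sums
  (`Torus.integral_patchTorus`: `4·25ⁿ` cells of mass `mₙ⁻² ∫Θ`), `|Θ| ≤ 10`,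
  `‖∇ρ_n‖ = mₙ ‖∇Θ‖ ≤ C 5ⁿ`, and the `Ḣ⁻¹` bound from the vanishing cell averages
  (`Torus.eHomSobolevSeminorm_neg_one_le_of_cellwise`: `≤ 2π √2 · 2 · mₙ⁻¹ = 2π√2 · 5⁻ⁿ`).

## References

* E. Bruè, C. De Lellis, *Anomalous dissipation for the forced 3D Navier–Stokes equations*,
  Comm. Math. Phys. 400 (2023), Thm. 4.1 (a), (b), (4.9)–(4.10).
* G. Alberti, G. Crippa, A. L. Mazzucato, *Exponential self-similar mixing by incompressible
  flows*, J. Amer. Math. Soc. 32 (2019), §6.2, Lemma 18, §6.4, Rem. 20 (iii)–(iv).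
-/

noncomputable section

open MeasureTheory Set Filter Function
open scoped Topology NNReal ContDiff InnerProductSpace

namespace Literature.Analysis.FluidPDE

namespace QuasiSelfSimilar

open FunctionSpaces FunctionSpaces.Torus

variable {N : ℕ} {V : Fin N → ℝ → EuclideanSpace ℝ (Fin 2) → EuclideanSpace ℝ (Fin 2)}
  {Θ : Fin N → ℝ → EuclideanSpace ℝ (Fin 2) → ℝ} {ι : ℕ → (Fin 2 → ℤ) → Fin N}

/-! ## Pointwise structure of the patched fields -/

/-- `ρ_n(t, x) = Θ_{ι(Q)}(t, 2·5ⁿ(y - r(Q)))` with `y = repr x ∈ Q`: the block label and the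
local coordinate seen at a torus point (unfolding BDL (4.3)). [folklore] -/
theorem scalar_eq (Θ : Fin N → ℝ → EuclideanSpace ℝ (Fin 2) → ℝ) (ι : ℕ → (Fin 2 → ℤ) → Fin N)
    (n : ℕ) (t : ℝ) (x : UnitAddTorus (Fin 2)) :
    scalar Θ ι n t x = Θ (ι n (cellIndex (mesh n) (repr x))) t (cellCoord (mesh n) (repr x)) := rfl

/-- `v_n(t, x) = mₙ⁻¹ V_{ι(Q)}(t, 2·5ⁿ(y - r(Q)))` (unfolding BDL (4.4)). [folklore] -/
theorem velocity_eq (V : Fin N → ℝ → EuclideanSpace ℝ (Fin 2) → EuclideanSpace ℝ (Fin 2))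
    (ι : ℕ → (Fin 2 → ℤ) → Fin N) (n : ℕ) (t : ℝ) (x : UnitAddTorus (Fin 2)) :
    velocity V ι n t x =
      ((mesh n : ℝ)⁻¹) • V (ι n (cellIndex (mesh n) (repr x))) t (cellCoord (mesh n) (repr x)) := rfl

/-- The fundamental cube lies in the closed square. [folklore] -/
theorem unitCube_subset_closedSquare : unitCube (Fin 2) ⊆ closedSquare :=
  fun _ hz k => Ico_subset_Icc_self (hz k)

/-- The local coordinate `cellCoord (mesh n) (repr x)` of a torus point lies in the closed square. [folklore] -/
theorem cellCoord_repr_mem_closedSquare (n : ℕ) (x : UnitAddTorus (Fin 2)) :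
    cellCoord (mesh n) (repr x) ∈ closedSquare :=
  unitCube_subset_closedSquare (cellCoord_mem_unitCube _ _)

/-- The closed square is compact. [folklore] -/
theorem isCompact_closedSquare : IsCompact closedSquare := by
  let e : EuclideanSpace ℝ (Fin 2) ≃ₜ (Fin 2 → ℝ) := PiLp.homeomorph 2 (fun _ : Fin 2 => ℝ)
  have he : ∀ (z : EuclideanSpace ℝ (Fin 2)) (k : Fin 2), e z k = z k := fun _ _ => rfl
  have h : closedSquare = e ⁻¹' Set.pi univ fun _ => Icc (0 : ℝ) 1 := by
    ext z; simp only [closedSquare, mem_setOf_eq, Set.mem_preimage, Set.mem_univ_pi, he]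
  rw [h, e.isCompact_preimage]
  exact isCompact_univ_pi fun _ => isCompact_Icc

/-- `[0,1] × [0,1]²` is compact. [folklore] -/
theorem isCompact_Icc_prod_closedSquare : IsCompact (Icc (0 : ℝ) 1 ×ˢ closedSquare) :=
  isCompact_Icc.prod isCompact_closedSquare

/-! ## Transport and incompressibility of the patched family -/

/-- Time slices of the blocks are `Cⁿ` for every finite `n`. [folklore] -/
theorem contDiff_slice {X : Type*} [NormedAddCommGroup X] [NormedSpace ℝ X]
    {Φ : ℝ → EuclideanSpace ℝ (Fin 2) → X} (hΦ : ContDiff ℝ ((⊤ : ℕ∞) : WithTop ℕ∞) (uncurry Φ))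
    (t : ℝ) (n : ℕ) : ContDiff ℝ n (Φ t) :=
  ((hΦ.of_le ENat.LEInfty.out).comp (contDiff_prodMk_right t) : _)

/-- Time lines of the blocks are `Cⁿ` for every finite `n`. [folklore] -/
theorem contDiff_line {X : Type*} [NormedAddCommGroup X] [NormedSpace ℝ X]
    {Φ : ℝ → EuclideanSpace ℝ (Fin 2) → X} (hΦ : ContDiff ℝ ((⊤ : ℕ∞) : WithTop ℕ∞) (uncurry Φ))
    (z : EuclideanSpace ℝ (Fin 2)) (n : ℕ) : ContDiff ℝ n fun s => Φ s z :=
  ((hΦ.of_le ENat.LEInfty.out).comp (contDiff_prodMk_left z) : _)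

/-- **Space derivative of the patched scalar**: `D ρ_n(t)(x) = mₙ • DΘ_{label}(t)(coord)`, for
`t ∈ [0,1]` where `ρ_n(t)` is smooth (BDL (4.3); ACM §6.2). [folklore] -/
theorem fderiv_scalar (hB : IsBuildingBlockFamily V Θ) {n : ℕ} {t : ℝ}
    (hs : IsSmooth (scalar Θ ι n t)) (x : UnitAddTorus (Fin 2)) :
    Torus.fderiv (scalar Θ ι n t) x =
      (mesh n : ℝ) • fderiv ℝ (Θ (ι n (cellIndex (mesh n) (repr x))) t) (cellCoord (mesh n) (repr x)) :=
  fderiv_patchTorus (G := fun i => Θ i t) (mesh_pos n)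
    (fun i => contDiff_slice (hB.smooth_scalar i) t 1) (hs.isContDiff ENat.LEInfty.out) x

/-- **Space derivative of the patched velocity**: `D v_n(t)(x) = DV_{label}(t)(coord)` (the
factors `mₙ⁻¹` of (4.4) and `mₙ` of the chain rule cancel), for `t` where `v_n(t)` is smooth. [folklore] -/
theorem fderiv_velocity (hB : IsBuildingBlockFamily V Θ) {n : ℕ} {t : ℝ}
    (hv : IsSmooth (velocity V ι n t)) (x : UnitAddTorus (Fin 2)) :
    Torus.fderiv (velocity V ι n t) x = fderiv ℝ (V (ι n (cellIndex (mesh n) (repr x))) t) (cellCoord (mesh n) (repr x)) := by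
  have hm : (mesh n : ℝ) ≠ 0 := by exact_mod_cast (mesh_pos n).ne'
  have hG : ∀ i, ContDiff ℝ 1 (fun z => ((mesh n : ℝ)⁻¹) • V i t z) := fun i =>
    (contDiff_slice (hB.smooth_velocity i) t 1).const_smul _
  have h := fderiv_patchTorus (G := fun i z => ((mesh n : ℝ)⁻¹) • V i t z) (mesh_pos n) hG
    (hv.isContDiff ENat.LEInfty.out) x
  -- `velocity V ι n t = patchTorus … (mₙ⁻¹ • V · t)` definitionally
  change Torus.fderiv (patchTorus (mesh n) (ι n) fun i z => ((mesh n : ℝ)⁻¹) • V i t z) x = _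
  rw [h]
  change (mesh n : ℝ) • fderiv ℝ (fun z => ((mesh n : ℝ)⁻¹) • V (ι n (cellIndex (mesh n) (repr x))) t z) (cellCoord (mesh n) (repr x)) = _
  have hd : DifferentiableAt ℝ (V (ι n (cellIndex (mesh n) (repr x))) t) (cellCoord (mesh n) (repr x)) :=
    ((contDiff_slice (hB.smooth_velocity _) t 1).differentiable one_ne_zero) _
  rw [fderiv_fun_const_smul hd, smul_smul, mul_inv_cancel₀ hm, one_smul]

/-- Components of the torus derivative: `D(u ·ⱼ)(x) w = (Du(x) w)ⱼ` for `C¹` fields. [folklore] -/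
theorem fderiv_apply_comp {d : Type*} [Fintype d] {u : UnitAddTorus d → EuclideanSpace ℝ d}
    (hu : IsContDiff 1 u) (j : d) (x : UnitAddTorus d) :
    Torus.fderiv (fun y => u y j) x =
      (EuclideanSpace.proj j : EuclideanSpace ℝ d →L[ℝ] ℝ).comp (Torus.fderiv u x) := by
  have hd : DifferentiableAt ℝ (liftAt u x) 0 :=
    ((hu.liftAt x).differentiable one_ne_zero).differentiableAt
  have h := ((EuclideanSpace.proj j : EuclideanSpace ℝ d →L[ℝ] ℝ).hasFDerivAt.comp 0 hd.hasFDerivAt)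
  exact h.fderiv

/-- **The patched family solves the transport equation with divergence-free drift**
(Bruè–De Lellis 2023, Thm. 4.1: "a family of smooth solutions to the transport equation";
ACM 2019, §6.2): given building blocks (BDL §4.1 (i)–(iii)) and the joint smoothness of the
patched `ρ_n`, `v_n` on `[0,1] × T²`, one has `∂ₜρ_n + v_n·∇ρ_n = 0` and `div v_n = 0` on
`[0,1] × T²` — in every half-open square both reduce to the block identities at
`(t, 2·5ⁿ(y - r(Q)))`. [cite: BrueDeLellisCMP2023, Thm. 4.1] -/
theorem isClassicalScalarTransportOn (hB : IsBuildingBlockFamily V Θ) {n : ℕ}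
    (hs : Torus.IsSmoothSpaceTimeOn (Icc 0 1) (scalar Θ ι n))
    (hv : Torus.IsSmoothSpaceTimeOn (Icc 0 1) (velocity V ι n)) :
    Torus.IsClassicalScalarTransportOn (Icc 0 1) 0 (velocity V ι n) (scalar Θ ι n) where
  smooth_velocity := hv
  smooth_scalar := hs
  transport t ht x := by
    set i := ι n (cellIndex (mesh n) (repr x)) with hi
    set z := cellCoord (mesh n) (repr x) with hz
    have hm : (mesh n : ℝ) ≠ 0 := by exact_mod_cast (mesh_pos n).ne'
    -- the time derivative acts on the block
    have h1 : Torus.timeDerivWithin (Icc 0 1) (scalar Θ ι n) t x = deriv (fun s => Θ i s z) t := by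
      change derivWithin (fun s => Θ i s z) (Icc 0 1) t = _
      exact ((contDiff_line (hB.smooth_scalar i) z 1).differentiable one_ne_zero
        t).derivWithin (uniqueDiffOn_Icc zero_lt_one t ht)
    -- the advection term
    have h2 : ⟪velocity V ι n t x, Torus.gradient (scalar Θ ι n t) x⟫_ℝ =
        fderiv ℝ (Θ i t) z (V i t z) := by
      have hg : Torus.gradient (scalar Θ ι n t) x =
          (InnerProductSpace.toDual ℝ _).symm (Torus.fderiv (scalar Θ ι n t) x) := rfl
      rw [hg, real_inner_comm, InnerProductSpace.toDual_symm_apply,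
        fderiv_scalar hB (hs.isSmooth_slice ht), velocity_eq]
      rw [FunLike.coe_smul, Pi.smul_apply, map_smul, smul_eq_mul, smul_eq_mul,
        ← mul_assoc, mul_inv_cancel₀ hm, one_mul]
    rw [h1, h2, zero_mul]
    exact hB.transport i t ht z (cellCoord_repr_mem_closedSquare n x)
  divFree t ht x := by
    have hvs : IsSmooth (velocity V ι n t) := hv.isSmooth_slice ht
    have h1 : IsContDiff 1 (velocity V ι n t) := hvs.isContDiff ENat.LEInfty.out
    rw [Torus.divergence]
    have hcomp : ∀ j, Torus.partialDeriv j (fun y => velocity V ι n t y j) x =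
        fderiv ℝ (V (ι n (cellIndex (mesh n) (repr x))) t) (cellCoord (mesh n) (repr x)) (EuclideanSpace.single j 1) j := by
      intro j
      rw [partialDeriv_eq_fderiv_apply ((hvs.apply j).isContDiff ENat.LEInfty.out),
        fderiv_apply_comp h1, ContinuousLinearMap.comp_apply, fderiv_velocity hB hvs]
      rfl
    simp_rw [hcomp]
    exact hB.divFree _ t ht _ (cellCoord_repr_mem_closedSquare n x)

/-! ## The `C^{j,r}` scaling estimate -/

/-- The mesh as a real power: `mₙ^e = 2^e 5^{e n}`. [folklore] -/
theorem mesh_rpow (n : ℕ) (e : ℝ) : (mesh n : ℝ) ^ e = (2 : ℝ) ^ e * (5 : ℝ) ^ (e * n) := by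
  rw [cast_mesh, Real.mul_rpow (by norm_num) (by positivity), mul_comm e n,
    Real.rpow_mul (by norm_num), Real.rpow_natCast]

/-- **The `C^{j,r}` scaling estimate** (Bruè–De Lellis 2023, Thm. 4.1 (a) and (4.10);
Alberti–Crippa–Mazzucato 2019, Lemma 18, Rem. 20 (iii)). Let `Φ_i(t, z)` be jointly smooth
blocks (in the applications: `∂ₜᵏV_i` and `∂ₜᵏ(DV_i[V_i])`) and let `F n t` be smooth fields on
`T²` which, for `t ∈ [0,1]`, are the level-`n` patches of the blocks `mₙ⁻¹ Φ_i(t, ·)`. Then there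
is `C` with `‖F n t‖_{C^{j,r}(T²)} ≤ C 5^{(j+r-1)n}` for all `n` and `t ∈ [0,1]`: the block
derivatives up to order `j+1` are bounded on the compact `[0,1] × [0,1]²`, and
`Torus.eContDiffHolderNorm_patchTorus_le` gives `mₙ^{j+r} · mₙ⁻¹ · const`, `mₙ = 2·5ⁿ`. [cite: BrueDeLellisCMP2023, Thm. 4.1 (a)] -/
theorem exists_holder_bound {X : Type*} [NormedAddCommGroup X] [NormedSpace ℝ X]
    {Φ : Fin N → ℝ → EuclideanSpace ℝ (Fin 2) → X}
    (hΦ : ∀ i, ContDiff ℝ ((⊤ : ℕ∞) : WithTop ℕ∞) (uncurry (Φ i)))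
    {F : ℕ → ℝ → UnitAddTorus (Fin 2) → X} (hF : ∀ n, ∀ t ∈ Icc (0 : ℝ) 1, IsSmooth (F n t))
    (hFeq : ∀ n, ∀ t ∈ Icc (0 : ℝ) 1,
      F n t = patchTorus (mesh n) (ι n) (fun i z => ((mesh n : ℝ)⁻¹) • Φ i t z))
    (j : ℕ) {r : ℝ≥0} (hr : r ≤ 1) :
    ∃ C : ℝ, ∀ n, ∀ t ∈ Icc (0 : ℝ) 1,
      eContDiffHolderNorm j r (F n t) ≤ ENNReal.ofReal (C * (5 : ℝ) ^ (((j : ℝ) + r - 1) * n)) := by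
  -- Step 1: uniform bounds of the block derivatives on `[0,1] × [0,1]²`
  have hbd : ∀ i' : ℕ, ∃ M : ℝ, 0 ≤ M ∧ ∀ i, ∀ t ∈ Icc (0 : ℝ) 1, ∀ z ∈ closedSquare,
      i' ≤ j + 1 → ‖iteratedFDeriv ℝ i' (Φ i t) z‖ ≤ M := by
    intro i'
    by_cases hi' : i' ≤ j + 1
    · have hone : ∀ i, ∃ M : ℝ, 0 ≤ M ∧ ∀ p ∈ Icc (0 : ℝ) 1 ×ˢ closedSquare,
          ‖iteratedFDeriv ℝ i' (fun z => uncurry (Φ i) (p.1, z)) p.2‖ ≤ M := fun i =>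
        exists_forall_norm_iteratedFDeriv_slice_le ((hΦ i).of_le ENat.LEInfty.out)
          isCompact_Icc_prod_closedSquare hi'
      choose M hM0 hM using hone
      refine ⟨∑ i, M i, Finset.sum_nonneg fun i _ => hM0 i, fun i t ht z hz _ => ?_⟩
      exact (hM i (t, z) ⟨ht, hz⟩).trans
        (Finset.single_le_sum (fun k _ => hM0 k) (Finset.mem_univ i))
    · exact ⟨0, le_rfl, fun _ _ _ _ _ h => absurd h hi'⟩
  choose M hM0 hM using hbd
  set S : ℝ := (∑ i ∈ Finset.range (j + 1), M i) + M (j + 1) + 2 * M j with hS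
  refine ⟨(2 : ℝ) ^ ((j : ℝ) + r - 1) * S, fun n t ht => ?_⟩
  have hm := mesh_pos n
  have hm' : (0 : ℝ) < mesh n := by exact_mod_cast hm
  -- Step 2: the field is the patch of the blocks `mₙ⁻¹ • Φ i t`
  set G : Fin N → EuclideanSpace ℝ (Fin 2) → X := fun i z => ((mesh n : ℝ)⁻¹) • Φ i t z with hG
  have hGc : ∀ i, ContDiff ℝ (j + 1) (G i) := fun i =>
    (contDiff_slice (hΦ i) t (j + 1)).const_smul _
  have hW : IsContDiff (j + 1) (patchTorus (mesh n) (ι n) G) := by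
    have h : IsContDiff ((j + 1 : ℕ) : WithTop ℕ∞) (F n t) := (hF n t ht).isContDiff ENat.LEInfty.out
    rwa [hFeq n t ht] at h
  have hGb : ∀ i' ≤ j + 1, ∀ l, ∀ z ∈ unitCube (Fin 2),
      ‖iteratedFDeriv ℝ i' (G l) z‖ ≤ (mesh n : ℝ)⁻¹ * M i' := by
    intro i' hi' l z hz
    have hz' : z ∈ closedSquare := unitCube_subset_closedSquare hz
    rw [hG]
    dsimp only
    rw [iteratedFDeriv_const_smul_apply'
      (((contDiff_slice (hΦ l) t (j + 1)).of_le (by exact_mod_cast hi')).contDiffAt),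
      norm_smul, Real.norm_eq_abs, abs_of_pos (inv_pos.2 hm')]
    exact mul_le_mul_of_nonneg_left (hM i' l t ht z hz' hi') (inv_nonneg.2 hm'.le)
  have h := eContDiffHolderNorm_patchTorus_le hm hGc hW (M := fun i' => (mesh n : ℝ)⁻¹ * M i')
    (fun i' => mul_nonneg (inv_nonneg.2 hm'.le) (hM0 i')) hGb hr
  rw [hFeq n t ht]
  refine h.trans (le_of_eq (congrArg ENNReal.ofReal ?_))
  -- Step 3: `mₙ^{j+r} · mₙ⁻¹ · S = 2^{j+r-1} S · 5^{(j+r-1)n}`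
  have h1 : (∑ i' ∈ Finset.range (j + 1), (mesh n : ℝ)⁻¹ * M i') + (mesh n : ℝ)⁻¹ * M (j + 1) +
      2 * ((mesh n : ℝ)⁻¹ * M j) = (mesh n : ℝ)⁻¹ * S := by
    rw [hS, ← Finset.mul_sum]; ring
  have h2 : (mesh n : ℝ) ^ ((j : ℝ) + r) * (mesh n : ℝ)⁻¹ = (mesh n : ℝ) ^ ((j : ℝ) + r - 1) := by
    rw [Real.rpow_sub_one hm'.ne', div_eq_mul_inv]
  rw [h1, ← mul_assoc, h2, mesh_rpow]
  ring

/-! ## The bounds (b) -/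

/-- `|ρ_n(t, x)| ≤ 10` for `t ∈ [0,1]` (BDL Thm. 4.1 (b), read off the blocks). [cite: BrueDeLellisCMP2023, Thm. 4.1 (b)] -/
theorem abs_scalar_le (hB : IsBuildingBlockFamily V Θ) (n : ℕ) {t : ℝ} (ht : t ∈ Icc (0 : ℝ) 1)
    (x : UnitAddTorus (Fin 2)) : |scalar Θ ι n t x| ≤ 10 :=
  hB.abs_le _ t ht _ (cellCoord_repr_mem_closedSquare n x)

/-- `∫_{T²} ρ_n(t) = 0`: the `4·25ⁿ` squares contribute `mₙ⁻² ∫_{[0,1)²} Θ_{ι(Q)}(t) = 0` each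
(BDL Thm. 4.1 (b)). [cite: BrueDeLellisCMP2023, Thm. 4.1 (b)] -/
theorem integral_scalar (hB : IsBuildingBlockFamily V Θ) (n : ℕ) {t : ℝ} (ht : t ∈ Icc (0 : ℝ) 1) :
    ∫ x, scalar Θ ι n t x = 0 := by
  have h := integral_patchTorus (G := fun i => Θ i t) (ι := ι n) (mesh_pos n) fun κ =>
    integrableOn_unitCube_of_continuous (contDiff_slice (hB.smooth_scalar _) t 0).continuous
  change ∫ x, patchTorus (mesh n) (ι n) (fun i => Θ i t) x = 0
  rw [h]
  simp [hB.zeroMean _ t ht]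

/-- `∫_{T²} ρ_n(t)² = 1`: `4·25ⁿ` squares of mass `mₙ⁻² · 1` each (BDL Thm. 4.1 (b)). [cite: BrueDeLellisCMP2023, Thm. 4.1 (b)] -/
theorem integral_scalar_sq (hB : IsBuildingBlockFamily V Θ) (n : ℕ) {t : ℝ}
    (ht : t ∈ Icc (0 : ℝ) 1) : ∫ x, scalar Θ ι n t x ^ 2 = 1 := by
  have hm : (mesh n : ℝ) ≠ 0 := by exact_mod_cast (mesh_pos n).ne'
  have h := integral_patchTorus (G := fun i z => Θ i t z ^ 2) (ι := ι n) (mesh_pos n) fun κ =>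
    integrableOn_unitCube_of_continuous ((contDiff_slice (hB.smooth_scalar _) t 0).continuous.pow 2)
  change ∫ x, patchTorus (mesh n) (ι n) (fun i z => Θ i t z ^ 2) x = 1
  rw [h]
  simp_rw [hB.unitL2 _ t ht]
  rw [Finset.sum_const, Finset.card_univ, Fintype.card_fun, Fintype.card_fin, Fintype.card_fin,
    nsmul_eq_mul, mul_one, smul_eq_mul]
  push_cast
  exact inv_mul_cancel₀ (pow_ne_zero _ hm)

/-- Vanishing averages on the squares of the tiling: `∫_{Q_κ} ρ_n(t) ∘ proj = 0` for every
square `Q_κ` of `𝒬(2·5ⁿ)` in the fundamental domain (the hypothesis of the `Ḣ⁻¹` bound). [folklore] -/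
theorem setIntegral_latticeCell_scalar (hB : IsBuildingBlockFamily V Θ) (n : ℕ) {t : ℝ}
    (ht : t ∈ Icc (0 : ℝ) 1) (κ : Fin 2 → Fin (mesh n)) :
    ∫ y in latticeCell (mesh n) (fun i => ((κ i : ℕ) : ℤ)), scalar Θ ι n t (proj y) = 0 := by
  have h := setIntegral_latticeCell_patchTorus_proj (G := fun i => Θ i t) (ι := ι n) (mesh_pos n) κ
  change ∫ y in latticeCell (mesh n) (fun i => ((κ i : ℕ) : ℤ)),
    patchTorus (mesh n) (ι n) (fun i => Θ i t) (proj y) = 0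
  rw [h, hB.zeroMean _ t ht, smul_zero]

/-- **The `Ḣ⁻¹` bound** `‖ρ_n(t)‖_{Ḣ⁻¹} ≤ 2π√2 · 5⁻ⁿ` (BDL Thm. 4.1 (b): `≤ C 5⁻ⁿ`), from the
vanishing averages on the `4·25ⁿ` squares, `‖ρ_n(t)‖_{L²} = 1` and
`Torus.eHomSobolevSeminorm_neg_one_le_of_cellwise` (`2π (√2/mₙ) 2^{2/2} · 1`, `mₙ = 2·5ⁿ`). [cite: BrueDeLellisCMP2023, Thm. 4.1 (b)] -/
theorem eHomSobolevSeminorm_scalar_le (hB : IsBuildingBlockFamily V Θ) (n : ℕ) {t : ℝ}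
    (ht : t ∈ Icc (0 : ℝ) 1) (hs : IsSmooth (scalar Θ ι n t)) :
    eHomSobolevSeminorm (-1) (fun x => (scalar Θ ι n t x : ℂ)) ≤
      ENNReal.ofReal (2 * Real.pi * Real.sqrt 2 * ((5 : ℝ) ^ n)⁻¹) := by
  have hc : Continuous (scalar Θ ι n t) := hs.continuous
  have h := eHomSobolevSeminorm_neg_one_le_of_cellwise hc (mesh_pos n)
    (setIntegral_latticeCell_scalar hB n ht)
  -- `‖ρ_n(t)‖_{L²} = 1`
  have hL2 : (∫⁻ x, ‖scalar Θ ι n t x‖ₑ ^ (2 : ℝ)) = 1 := by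
    have h1 : ∀ x, ‖scalar Θ ι n t x‖ₑ ^ (2 : ℝ) = ENNReal.ofReal (scalar Θ ι n t x ^ 2) := fun x => by
      rw [← ofReal_norm, Real.norm_eq_abs, ENNReal.ofReal_rpow_of_nonneg (abs_nonneg _) (by norm_num),
        Real.rpow_two, sq_abs]
    simp_rw [h1]
    rw [← ofReal_integral_eq_lintegral_ofReal (f := fun x => scalar Θ ι n t x ^ 2)
      ((hc.pow 2).integrable_unitAddTorus) (ae_of_all _ fun x => sq_nonneg _),
      integral_scalar_sq hB n ht, ENNReal.ofReal_one]
  rw [hL2, ENNReal.one_rpow, mul_one, Fintype.card_fin] at h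
  refine h.trans (le_of_eq ?_)
  have h2 : (2 : ENNReal) ^ (((2 : ℕ) : ℝ) / 2) = ENNReal.ofReal 2 := by
    rw [show (((2 : ℕ) : ℝ) / 2) = (1 : ℝ) by norm_num, ENNReal.rpow_one, ENNReal.ofReal_ofNat]
  rw [h2, ← ENNReal.ofReal_mul (by positivity), cast_mesh]
  congr 1
  have h5 : (5 : ℝ) ^ n ≠ 0 := pow_ne_zero _ (by norm_num)
  field_simp
  push_cast
  ring

/-- **The gradient bound** `‖∇ρ_n(t)(x)‖ ≤ B · 2·5ⁿ` with `B = max ‖∇Θ_i‖` over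
`[0,1] × [0,1]²` (BDL Thm. 4.1 (b): `≤ C 5ⁿ`; `Dρ_n = mₙ DΘ`). [cite: BrueDeLellisCMP2023, Thm. 4.1 (b)] -/
theorem exists_norm_gradient_scalar_le (hB : IsBuildingBlockFamily V Θ)
    (hs : ∀ n, Torus.IsSmoothSpaceTimeOn (Icc 0 1) (scalar Θ ι n)) :
    ∃ B : ℝ, 0 ≤ B ∧ ∀ n, ∀ t ∈ Icc (0 : ℝ) 1, ∀ x,
      ‖Torus.gradient (scalar Θ ι n t) x‖ ≤ B * (2 * 5 ^ n) := by
  -- bound of `‖DΘ_i(t)(z)‖` on the compact `[0,1] × [0,1]²`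
  have hone : ∀ i, ∃ M : ℝ, 0 ≤ M ∧ ∀ p ∈ Icc (0 : ℝ) 1 ×ˢ closedSquare,
      ‖iteratedFDeriv ℝ 1 (fun z => uncurry (Θ i) (p.1, z)) p.2‖ ≤ M := fun i =>
    exists_forall_norm_iteratedFDeriv_slice_le ((hB.smooth_scalar i).of_le ENat.LEInfty.out)
      isCompact_Icc_prod_closedSquare le_rfl
  choose M hM0 hM using hone
  refine ⟨∑ i, M i, Finset.sum_nonneg fun i _ => hM0 i, fun n t ht x => ?_⟩
  have hgrad : Torus.gradient (scalar Θ ι n t) x =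
      (InnerProductSpace.toDual ℝ _).symm (Torus.fderiv (scalar Θ ι n t) x) := rfl
  rw [hgrad, LinearIsometryEquiv.norm_map, fderiv_scalar hB ((hs n).isSmooth_slice ht), norm_smul,
    Real.norm_eq_abs, abs_of_pos (by exact_mod_cast mesh_pos n : (0 : ℝ) < mesh n), cast_mesh,
    mul_comm]
  refine mul_le_mul_of_nonneg_right ?_ (by positivity)
  have h := hM (ι n (cellIndex (mesh n) (repr x))) (t, cellCoord (mesh n) (repr x)) ⟨ht, cellCoord_repr_mem_closedSquare n x⟩
  rw [norm_iteratedFDeriv_one] at h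
  exact h.trans (Finset.single_le_sum (fun k _ => hM0 k) (Finset.mem_univ _))

end QuasiSelfSimilar

end Literature.Analysis.FluidPDE
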